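import Summits.QuantumAdvantage.QuantumAdvantage.Theorems.LinnikCubicClassGroupsDegreeOnePrimesEscapeFrobeniusWindowPsiDH
import Summits.QuantumAdvantage.QuantumAdvantage.Theorems.LinnikCubicClassGroupsDegreeOnePrimesEscapeShortIntervalDHPrelims
import HarnessLib

/-!
# Chebotarev in SHORT INTERVALS in the Linnik range with Deuring–Heilbronn-sharp error, every class

Topic `Summits/QuantumAdvantage/QuantumAdvantage/Theorems`, cell B2b-1 (linnik-cubic), PART A (gen 17); helper
toward the crux `DegreeOnePrimesEscape` (stmt-QuantumAdvantage-11543) of route `LinnikCubicClassGroups`.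
HONEST FRAMING: the value of this file is a THEOREM (kernel-checked, GRH-free, Siegel-free, unconditional) — NOT
summit progress (the route still rests on the hypothesis-type target `PureCubicClassNumberHard`).

**Theorem (`frobeniusClass_shortInterval_dh`).**  For `n > 1` and `0 < κ ≤ 1` there are `δ, L, c > 0` such that
for every Galois number field `N/ℚ` of degree `n`, every `σ ∈ Gal(N/ℚ)` with class `C = C(σ)`, every
`x ≥ |d_N|^L` and every `h` with `x^{1−δ} ≤ h ≤ x` (`S(y) = Σ_{p ≤ y, p ∤ d_N, Frob_p ∈ C} log p`,
`Δ = S(x+h) − S(x)`, `δ_C = |C|/|G|`):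
(A) if `ζ_N` has no real zero in `(1 − c/(log|d_N| + log 4), 1)` then `|Δ − δ_C h| ≤ κ δ_C h`;
(B) if `β₁` is such a zero and `I = ((x+h)^{β₁} − x^{β₁})/β₁ = ∫_x^{x+h} t^{β₁−1} dt`, then
    `|Δ − δ_C (h − I)| ≤ κ δ_C (h − I)` if `ζ_{N^{⟨σ⟩}}(β₁) = 0` — the error is RELATIVE to the flat main
    term, which is positive (`h − I ≥ (h/2) min(1, (1−β₁) log x)`, `half_min_mul_le_flat`) — and
    `|Δ − δ_C (h + I)| ≤ κ δ_C h` otherwise.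
Compared with `frobeniusClass_shortInterval` (absolute error `κ δ_C h` in the flat regime, which is Balog–Ono 2001 /
Gun–Naik 2024 Thm. 7 with per-degree constants), the flat regime now carries the Deuring–Heilbronn phenomenon
(`FrobeniusWindowPsiDH`: the other zeros are repelled by `β₁`, error `≪ min(1,(1−β₁) log x)·h`) and Stark's
effective bound `1 − β₁ ≥ c₁(n) Q^{-2}` (for the prime-power junk, `junk_le_quarter_mul_rel`).  Consequence
(`…DHCorollaries`): EVERY interval `(x, x+h]` as above contains a prime `p ∤ d_N` with `Frob_p ∈ C`, for EVERY
class `C` of EVERY Galois `N/ℚ` — unconditionally, with no exceptional-character proviso.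
References: A. Balog, K. Ono, J. Number Theory 91 (2001) 356–371; S. Gun, S. L. Naik, arXiv:2405.04698, Thm. 7;
[LagariasMontgomeryOdlyzko1979, Thm. 1.1]; [ThornerZaman2019, Thm. 3.2]; [Stark1974, Thm. 1'].
-/

noncomputable section

open scoped NumberField nonZeroDivisors Classical
open Finset Real Ideal NumberField IsDedekindDomain
open Literature.NumberTheory.NumberFields Literature.NumberTheory.LFunctions
  Literature.NumberTheory.LFunctions.NumberField Literature.NumberTheory.GaloisRepresentations

namespace Summit.QuantumAdvantage.QuantumAdvantage.Theorems.DegreeOnePrimesEscape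

variable {N : Type} [Field N] [NumberField N] [IsGalois ℚ N]

set_option maxHeartbeats 4000000 in
/-- **The Chebotarev density theorem in short intervals in the Linnik range with Deuring–Heilbronn-sharp
error, every conjugacy class of every Galois number field** (see the module docstring; `δ_C = |C(σ)|/|G|`,
`S(y) = Σ_{p ≤ y, p ∤ d_N, Frob_p ∈ C(σ)} log p`, `I = ((x+h)^{β₁} − x^{β₁})/β₁`): in the flat regime
`ζ_{N^{⟨σ⟩}}(β₁) = 0` the error is RELATIVE to the flat main term `δ_C (h − I)`. Unconditional.
[cite: LagariasMontgomeryOdlyzko1979, Theorem 1.1] [cite: ThornerZaman2019, Theorem 1.1] [cite: Stark1974, Theorem 1'] -/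
theorem frobeniusClass_shortInterval_dh (n : ℕ) (hn : 1 < n) {κ : ℝ} (hκ : 0 < κ) (hκ1 : κ ≤ 1) :
    ∃ δ L c : ℝ, 0 < δ ∧ δ ≤ 1 / 64 ∧ 0 < L ∧ 0 < c ∧ c ≤ 1 / 4 ∧ c ≤ 1 / (8 * ((2 * n).factorial : ℝ)) ∧
      ∀ (N : Type) [Field N] [NumberField N] [IsGalois ℚ N], Module.finrank ℚ N = n → ∀ σ : N ≃ₐ[ℚ] N,
      ∀ x h : ℝ, ((NumberField.discr N).natAbs : ℝ) ^ L ≤ x → x ^ (1 - δ) ≤ h → h ≤ x →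
        ((¬ ∃ β₁ : ℝ, dedekindZeta₁ N β₁ = 0 ∧
            1 - c / (Real.log ((NumberField.discr N).natAbs : ℝ) + Real.log 4) < β₁ ∧ β₁ < 1) →
            |(∑ p ∈ (Nat.primesLE ⌊x + h⌋₊).filter
                (fun p : ℕ => ¬ ((p : ℤ) ∣ NumberField.discr N) ∧
                  ∃ (Q : Ideal (𝓞 N)) (_ : Q.IsMaximal) (_ : Q.LiesOver (span {(p : ℤ)})) (φ g : N ≃ₐ[ℚ] N),
                    IsArithFrobAt ℤ φ Q ∧ Q.inertia (N ≃ₐ[ℚ] N) = ⊥ ∧ g * φ * g⁻¹ = σ), Real.log p) -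
              (∑ p ∈ (Nat.primesLE ⌊x⌋₊).filter
                (fun p : ℕ => ¬ ((p : ℤ) ∣ NumberField.discr N) ∧
                  ∃ (Q : Ideal (𝓞 N)) (_ : Q.IsMaximal) (_ : Q.LiesOver (span {(p : ℤ)})) (φ g : N ≃ₐ[ℚ] N),
                    IsArithFrobAt ℤ φ Q ∧ Q.inertia (N ≃ₐ[ℚ] N) = ⊥ ∧ g * φ * g⁻¹ = σ), Real.log p) -
              (Nat.card {τ : N ≃ₐ[ℚ] N // IsConj σ τ} : ℝ) / Nat.card (N ≃ₐ[ℚ] N) * h| ≤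
              κ * ((Nat.card {τ : N ≃ₐ[ℚ] N // IsConj σ τ} : ℝ) / Nat.card (N ≃ₐ[ℚ] N) * h)) ∧
        (∀ β₁ : ℝ, dedekindZeta₁ N β₁ = 0 →
          1 - c / (Real.log ((NumberField.discr N).natAbs : ℝ) + Real.log 4) < β₁ → β₁ < 1 →
          (dedekindZeta₁ (IntermediateField.fixedField (Subgroup.zpowers σ)) β₁ = 0 →
              |(∑ p ∈ (Nat.primesLE ⌊x + h⌋₊).filter
                  (fun p : ℕ => ¬ ((p : ℤ) ∣ NumberField.discr N) ∧
                    ∃ (Q : Ideal (𝓞 N)) (_ : Q.IsMaximal) (_ : Q.LiesOver (span {(p : ℤ)})) (φ g : N ≃ₐ[ℚ] N),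
                      IsArithFrobAt ℤ φ Q ∧ Q.inertia (N ≃ₐ[ℚ] N) = ⊥ ∧ g * φ * g⁻¹ = σ), Real.log p) -
                (∑ p ∈ (Nat.primesLE ⌊x⌋₊).filter
                  (fun p : ℕ => ¬ ((p : ℤ) ∣ NumberField.discr N) ∧
                    ∃ (Q : Ideal (𝓞 N)) (_ : Q.IsMaximal) (_ : Q.LiesOver (span {(p : ℤ)})) (φ g : N ≃ₐ[ℚ] N),
                      IsArithFrobAt ℤ φ Q ∧ Q.inertia (N ≃ₐ[ℚ] N) = ⊥ ∧ g * φ * g⁻¹ = σ), Real.log p) -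
                (Nat.card {τ : N ≃ₐ[ℚ] N // IsConj σ τ} : ℝ) / Nat.card (N ≃ₐ[ℚ] N) *
                  (h - ((x + h) ^ β₁ - x ^ β₁) / β₁)| ≤
                κ * ((Nat.card {τ : N ≃ₐ[ℚ] N // IsConj σ τ} : ℝ) / Nat.card (N ≃ₐ[ℚ] N) *
                  (h - ((x + h) ^ β₁ - x ^ β₁) / β₁))) ∧
          (dedekindZeta₁ (IntermediateField.fixedField (Subgroup.zpowers σ)) β₁ ≠ 0 →
              |(∑ p ∈ (Nat.primesLE ⌊x + h⌋₊).filter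
                  (fun p : ℕ => ¬ ((p : ℤ) ∣ NumberField.discr N) ∧
                    ∃ (Q : Ideal (𝓞 N)) (_ : Q.IsMaximal) (_ : Q.LiesOver (span {(p : ℤ)})) (φ g : N ≃ₐ[ℚ] N),
                      IsArithFrobAt ℤ φ Q ∧ Q.inertia (N ≃ₐ[ℚ] N) = ⊥ ∧ g * φ * g⁻¹ = σ), Real.log p) -
                (∑ p ∈ (Nat.primesLE ⌊x⌋₊).filter
                  (fun p : ℕ => ¬ ((p : ℤ) ∣ NumberField.discr N) ∧
                    ∃ (Q : Ideal (𝓞 N)) (_ : Q.IsMaximal) (_ : Q.LiesOver (span {(p : ℤ)})) (φ g : N ≃ₐ[ℚ] N),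
                      IsArithFrobAt ℤ φ Q ∧ Q.inertia (N ≃ₐ[ℚ] N) = ⊥ ∧ g * φ * g⁻¹ = σ), Real.log p) -
                (Nat.card {τ : N ≃ₐ[ℚ] N // IsConj σ τ} : ℝ) / Nat.card (N ≃ₐ[ℚ] N) *
                  (h + ((x + h) ^ β₁ - x ^ β₁) / β₁)| ≤
                κ * ((Nat.card {τ : N ≃ₐ[ℚ] N // IsConj σ τ} : ℝ) / Nat.card (N ≃ₐ[ℚ] N) * h))) := by
  have hn0 : (0 : ℝ) < n := by exact_mod_cast (lt_trans Nat.zero_lt_one hn)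
  have hn1 : (1 : ℝ) ≤ n := by exact_mod_cast hn.le
  -- the `ψ`-form input at precision `κ/4`
  have hκ4 : 0 < κ / 4 := by positivity
  have hκ41 : κ / 4 ≤ 1 := by linarith
  obtain ⟨δ, a₂, c, c', hδ0, hδ64, ha₂1, hc, hcn, hc'0, hc'c, hmain⟩ :=
    frobeniusWindowPsi_dichotomy_dh n hn hκ4 hκ41
  obtain ⟨c₁, hc₁, hc₁1, heff⟩ := Residue.one_sub_realZero_ge_condQn_rpow n hn
  -- the final window constant: also below Stark's odd-degree bound `1/(8(2n)!)`
  set c₂ : ℝ := min c' (1 / (8 * ((2 * n).factorial : ℝ))) with hc₂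
  have hc₂0 : 0 < c₂ := lt_min hc'0 (by positivity)
  have hc₂c' : c₂ ≤ c' := min_le_left _ _
  have hc₂fac : c₂ ≤ 1 / (8 * ((2 * n).factorial : ℝ)) := min_le_right _ _
  obtain ⟨L₀, hL₀0, hW⟩ := rpow_div_le_of_ge_window hc₂0 hκ4
  set e : ℝ := 1 + n * Real.log n / Real.log 3 with he
  have hlog3 : 0 < Real.log 3 := Real.log_pos (by norm_num)
  have hlogn : 0 ≤ Real.log n := Real.log_nonneg hn1
  have he0 : 0 ≤ (n : ℝ) * Real.log n / Real.log 3 := by positivity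
  have he1 : 1 ≤ e := by rw [he]; linarith
  set L₃ : ℝ := max 0 (64 / 11 * Real.log (480 * n / (κ * c₁))) with hL₃
  set L : ℝ := max (max (e * a₂) (32 * e)) (max L₀ L₃) with hL
  have hLea : e * a₂ ≤ L := le_trans (le_max_left _ _) (le_max_left _ _)
  have hL32 : 32 * e ≤ L := le_trans (le_max_right _ _) (le_max_left _ _)
  have hL8 : (8 : ℝ) ≤ L := by linarith
  have hLL₀ : L₀ ≤ L := le_trans (le_max_left _ _) (le_max_right _ _)
  have hLL₃ : L₃ ≤ L := le_trans (le_max_right _ _) (le_max_right _ _)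
  have hc4' : c ≤ 1 / 4 := by
    refine hcn.trans ?_
    rw [div_le_div_iff_of_pos_left one_pos (by positivity) (by norm_num)]; nlinarith
  refine ⟨δ, L, c₂, hδ0, hδ64, by linarith, hc₂0, hc₂c'.trans (hc'c.trans hc4'), hc₂fac,
    fun N _ _ _ hN σ x h hx hhx hhx' => ?_⟩
  -- sizes depending on `N`
  have hN1 : 1 < Module.finrank ℚ N := by rw [hN]; exact hn
  set d : ℝ := ((NumberField.discr N).natAbs : ℝ) with hd
  have hd3 : (3 : ℝ) ≤ d := three_le_natAbs_discr_real N hN1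
  obtain ⟨hd0, hd1⟩ : (0 : ℝ) < d ∧ (1 : ℝ) ≤ d := ⟨by linarith, by linarith⟩
  have hlogd0 : 0 < Real.log d := Real.log_pos (by linarith)
  have hlog4 : 0 < Real.log 4 := Real.log_pos (by norm_num)
  -- the fixed field of `⟨σ⟩`
  set H : Subgroup (N ≃ₐ[ℚ] N) := Subgroup.zpowers σ with hH
  set E : IntermediateField ℚ N := IntermediateField.fixedField H with hE
  have hfix : E.fixingSubgroup = H := IntermediateField.fixingSubgroup_fixedField H
  have hσE : σ ∈ E.fixingSubgroup := by rw [hfix]; exact Subgroup.mem_zpowers σ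
  haveI : IsCyclic E.fixingSubgroup := by rw [hfix]; infer_instance
  haveI : IsCyclic (N ≃ₐ[E] N) :=
    isCyclic_of_surjective (IntermediateField.fixingSubgroupEquiv E).toMonoidHom
      (IntermediateField.fixingSubgroupEquiv E).surjective
  have hcomm : ∀ a b : N ≃ₐ[E] N, Commute a b := fun a b => IsCyclic.commGroup.mul_comm a b
  haveI : FiniteDimensional E N := Module.Finite.of_restrictScalars_finite ℚ E N
  set τ' : N ≃ₐ[E] N := IntermediateField.fixingSubgroupEquiv E ⟨σ, hσE⟩ with hτ'
  set m : ℕ := Module.finrank E N with hm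
  have hcardm : Nat.card (N ≃ₐ[E] N) = m := IsGalois.card_aut_eq_finrank E N
  have horder : orderOf τ' = m := by
    rw [hτ', MulEquiv.orderOf_eq, Subgroup.orderOf_mk, ← Nat.card_zpowers, ← hH, ← hcardm,
      ← Nat.card_congr (IntermediateField.fixingSubgroupEquiv E).toEquiv, hfix]
  obtain ⟨χ₁, hχ₁, hA, hB, hB'⟩ := hmain E N hN
  -- the Frobenius weight of `σ`
  set w : Ideal (𝓞 E) → ℝ := fun I => if (∃ v : HeightOneSpectrum (𝓞 E),
    Algebra.IsUnramifiedIn (𝓞 N) v.asIdeal ∧ ∃ k : ℕ, I = v.asIdeal ^ k ∧ galFrob E N v ^ k = τ') then 1 else 0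
    with hwdef
  have hw : ∀ I, w I = if (∃ v : HeightOneSpectrum (𝓞 E), Algebra.IsUnramifiedIn (𝓞 N) v.asIdeal ∧
      ∃ k : ℕ, I = v.asIdeal ^ k ∧ galFrob E N v ^ k = τ') then 1 else 0 := fun I => rfl
  -- group-theoretic constants
  set ν : ℝ := (Nat.card (Subgroup.centralizer ({σ} : Set (N ≃ₐ[ℚ] N))) : ℝ) with hν
  have hνpos : 0 < ν := by rw [hν]; exact_mod_cast card_centralizer_pos σ
  set δC : ℝ := (Nat.card {τ : N ≃ₐ[ℚ] N // IsConj σ τ} : ℝ) / Nat.card (N ≃ₐ[ℚ] N) with hδC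
  have hG0 : (0 : ℝ) < Nat.card (N ≃ₐ[ℚ] N) := by exact_mod_cast Nat.card_pos
  have hδν : δC * ν = 1 := by
    rw [hδC, hν, div_mul_eq_mul_div, div_eq_one_iff_eq hG0.ne']
    exact_mod_cast card_isConj_mul_card_centralizer σ
  have hδCpos : 0 < δC := by
    by_contra h0; push Not at h0
    have : δC * ν ≤ 0 := mul_nonpos_of_nonpos_of_nonneg h0 hνpos.le
    linarith
  -- `x ≥ d^L`: the thresholds
  have hQd : ThornerZaman.condQn N ≤ d ^ e := by
    have h' := condQn_le_natAbs_discr_rpow N hN1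
    rw [hN] at h'; exact h'
  have hQ0 : (0 : ℝ) ≤ ThornerZaman.condQn N := by
    have := ThornerZaman.twelve_le_condQn (K := N) hN1; linarith
  have hmono : ∀ {a b : ℝ}, a ≤ b → d ^ a ≤ d ^ b := fun hab => Real.rpow_le_rpow_of_exponent_le hd1 hab
  have hQx : ThornerZaman.condQn N ^ a₂ ≤ x := by
    calc ThornerZaman.condQn N ^ a₂ ≤ (d ^ e) ^ a₂ := Real.rpow_le_rpow hQ0 hQd (by linarith)
      _ = d ^ (e * a₂) := by rw [Real.rpow_mul hd0.le]
      _ ≤ d ^ L := hmono hLea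
      _ ≤ x := hx
  have hQ12 : (12 : ℝ) ≤ ThornerZaman.condQn N := ThornerZaman.twelve_le_condQn (K := N) hN1
  have hQpos : (0 : ℝ) < ThornerZaman.condQn N := by linarith
  have hQ32 : ThornerZaman.condQn N ^ (32 : ℝ) ≤ x := by
    calc ThornerZaman.condQn N ^ (32 : ℝ) ≤ (d ^ e) ^ (32 : ℝ) := Real.rpow_le_rpow hQ0 hQd (by norm_num)
      _ = d ^ (e * 32) := by rw [Real.rpow_mul hd0.le]
      _ ≤ d ^ L := hmono (by linarith)
      _ ≤ x := hx
  -- `c₁ Q^{-2} ≤ 1`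
  have hc₁Q1 : c₁ * ThornerZaman.condQn N ^ (-(2 : ℝ)) ≤ 1 := by
    have h1 : ThornerZaman.condQn N ^ (-(2 : ℝ)) ≤ 1 :=
      Real.rpow_le_one_of_one_le_of_nonpos (by linarith) (by norm_num)
    have := mul_le_mul hc₁1 h1 (Real.rpow_nonneg hQ0 _) zero_le_one
    linarith
  have hL₀x : d ^ L₀ ≤ x := (hmono hLL₀).trans hx
  have hd8x : d ^ (8 : ℝ) ≤ x := (hmono hL8).trans hx
  have hx3 : (3 : ℝ) ≤ x := by
    have : d ≤ d ^ (8 : ℝ) := by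
      have := Real.rpow_le_rpow_of_exponent_le hd1 (show (1:ℝ) ≤ 8 by norm_num); rwa [Real.rpow_one] at this
    linarith
  have hx1 : 1 < x := by linarith
  have hx0 : 0 < x := by linarith
  have hxδ : 0 < x ^ (1 - δ) := Real.rpow_pos_of_pos hx0 _
  have hh0 : 0 < h := lt_of_lt_of_le hxδ hhx
  have hd8 : d ≤ x ^ (1 / 8 : ℝ) := by
    have := Real.rpow_le_rpow (Real.rpow_nonneg hd0.le _) hd8x (by norm_num : (0 : ℝ) ≤ 1 / 8)
    rwa [← Real.rpow_mul hd0.le, show (8 : ℝ) * (1 / 8) = 1 by norm_num, Real.rpow_one] at this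
  have hd8' : d ≤ (x + h) ^ (1 / 8 : ℝ) :=
    hd8.trans (Real.rpow_le_rpow hx0.le (by linarith) (by norm_num))
  -- the comparison `|m Δψ_σ − ν ΔS| ≤ 120 n x^{3/4} ≤ (κ/4) h`
  have hcomp :
      |(m : ℝ) * ((∑ k ∈ Icc 0 ⌊x + h⌋₊, ∑ I ∈ idealsOfNorm E k, w I * idealVonMangoldt I) -
          (∑ k ∈ Icc 0 ⌊x⌋₊, ∑ I ∈ idealsOfNorm E k, w I * idealVonMangoldt I)) -
        ν * ((∑ p ∈ (Nat.primesLE ⌊x + h⌋₊).filter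
          (fun p : ℕ => ¬ ((p : ℤ) ∣ NumberField.discr N) ∧
            ∃ (Q : Ideal (𝓞 N)) (_ : Q.IsMaximal) (_ : Q.LiesOver (span {(p : ℤ)})) (φ g : N ≃ₐ[ℚ] N),
              IsArithFrobAt ℤ φ Q ∧ Q.inertia (N ≃ₐ[ℚ] N) = ⊥ ∧ g * φ * g⁻¹ = σ), Real.log p) -
          (∑ p ∈ (Nat.primesLE ⌊x⌋₊).filter
          (fun p : ℕ => ¬ ((p : ℤ) ∣ NumberField.discr N) ∧
            ∃ (Q : Ideal (𝓞 N)) (_ : Q.IsMaximal) (_ : Q.LiesOver (span {(p : ℤ)})) (φ g : N ≃ₐ[ℚ] N),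
              IsArithFrobAt ℤ φ Q ∧ Q.inertia (N ≃ₐ[ℚ] N) = ⊥ ∧ g * φ * g⁻¹ = σ), Real.log p))| ≤
        κ / 4 * (c₁ * ThornerZaman.condQn N ^ (-(2 : ℝ))) * h := by
    have h1 := abs_card_mul_psiFrob_sub_le (N := N) E hcomm hσE hw hx1.le
    have h2 := abs_card_mul_psiFrob_sub_le (N := N) E hcomm hσE hw (by linarith : (1 : ℝ) ≤ x + h)
    rw [hcardm] at h1 h2
    have hj1 := classJunk_le (N := N) E hx1 hd8
    have hj2 := classJunk_le (N := N) E (by linarith : (1 : ℝ) < x + h) hd8'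
    rw [hcardm, hN] at hj1 hj2
    have h34 := rpow_threeQuarters_add_le hx0 hh0.le hhx'
    have hL₃' : 64 / 11 * Real.log (480 * n / (κ * c₁)) ≤ L := le_trans (le_max_right _ _) hLL₃
    have hjunk := junk_le_quarter_mul_rel (δ := δ) hn0 hκ hc₁ hd3 hL₃' (by linarith) hx hQpos hQ32 hδ64 hhx
    have e1 := h1.trans hj1
    have e2 := h2.trans hj2
    rw [abs_le] at e1 e2 ⊢
    constructor <;> nlinarith [e1.1, e1.2, e2.1, e2.2, h34, hjunk, Real.rpow_nonneg hx0.le (3 / 4 : ℝ)]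
  have hR : κ / 4 * (c₁ * ThornerZaman.condQn N ^ (-(2 : ℝ))) * h ≤ κ / 4 * h := by
    have := mul_le_mul_of_nonneg_left hc₁Q1 (by positivity : 0 ≤ κ / 4 * h)
    linarith
  have hcomp' := hcomp.trans hR
  -- `1/2 ≤ β₁` in the `c`-window
  have hβhalf_of : ∀ {cc β₁ : ℝ}, cc ≤ c → 1 - cc / (Real.log d + Real.log 4) < β₁ → 1 / 2 ≤ β₁ := by
    intro cc β₁ hcc hwin
    have hlog4' : 1 < Real.log 4 := by
      rw [show (4:ℝ) = 2 ^ 2 by norm_num, Real.log_pow]; have := Real.log_two_gt_d9; push_cast; linarith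
    have : cc / (Real.log d + Real.log 4) ≤ 1 / 4 := by
      rw [div_le_iff₀ (by linarith)]; nlinarith
    linarith
  refine ⟨fun hexc => ?_, fun β₁ hζ hwin hβ1 => ⟨fun hζE => ?_, fun hζE => ?_⟩⟩
  · -- (A): no zero in the `c'`-window; `|m Δψ − h| ≤ (κ/2) h` whether or not a zero hides in the `c`-window
    have h1 : |(m : ℝ) * ((∑ k ∈ Icc 0 ⌊x + h⌋₊, ∑ I ∈ idealsOfNorm E k, w I * idealVonMangoldt I) -
          (∑ k ∈ Icc 0 ⌊x⌋₊, ∑ I ∈ idealsOfNorm E k, w I * idealVonMangoldt I)) - h| ≤ κ / 2 * h := by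
      by_cases hz : ∃ β₁ : ℝ, dedekindZeta₁ N β₁ = 0 ∧
          1 - c / (Real.log ((NumberField.discr N).natAbs : ℝ) + Real.log 4) < β₁ ∧ β₁ < 1
      · obtain ⟨β₁, hζ, hwin, hβ1⟩ := hz
        have hβc' : β₁ ≤ 1 - c₂ / (Real.log d + Real.log 4) := by
          by_contra hlt
          exact hexc ⟨β₁, hζ, lt_of_not_ge hlt, hβ1⟩
        have hβhalf := hβhalf_of le_rfl hwin
        have hβ0 : 0 < β₁ := by linarith
        have hbd := hB β₁ hζ hwin hβ1 τ' w hw x h hQx hhx hhx'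
        rw [← hm] at hbd
        -- the secondary term: `I ≤ h x^{β₁−1} ≤ (κ/4) h`
        have hy : x ^ β₁ / β₁ ≤ κ / 4 * x := hW d hd3 x hL₀x β₁ hβhalf hβc'
        have hxβ : x ^ (β₁ - 1) ≤ κ / 4 := by
          have h2 : x ^ β₁ ≤ β₁ * (κ / 4 * x) := by rwa [div_le_iff₀' hβ0] at hy
          have h3 : β₁ * (κ / 4 * x) ≤ 1 * (κ / 4 * x) := mul_le_mul_of_nonneg_right hβ1.le (by positivity)
          rw [Real.rpow_sub_one hx0.ne', div_le_iff₀ hx0]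
          linarith
        have hI : ((x + h) ^ β₁ - x ^ β₁) / β₁ ≤ κ / 4 * h := by
          refine (rpow_window_div_le hx0 hh0.le hβ0 hβ1.le).trans ?_
          have := mul_le_mul_of_nonneg_left hxβ hh0.le
          linarith
        have := abs_le.1 hbd
        rw [abs_le]; constructor <;> linarith [this.1, this.2]
      · have hbd := hA τ' w hw x h hQx hhx hhx' hz
        rw [← hm] at hbd
        refine hbd.trans ?_
        nlinarith
    have key := window_transfer hνpos hδν h1 hcomp'
    refine key.trans ?_
    have hp : 0 ≤ κ * (δC * h) := by positivity
    linarith [hp]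
  · -- (B), `ζ_E(β₁) = 0`: the sign is `+1`, the error is relative to `μ = min(1,(1−β₁) log x)`
    have hwin' : 1 - c' / (Real.log d + Real.log 4) < β₁ := by
      have := div_le_div_of_nonneg_right hc₂c' (by linarith : 0 ≤ Real.log d + Real.log 4); linarith
    have hβhalf : 1 / 2 ≤ β₁ := hβhalf_of hc'c hwin'
    have hβ0 : 0 < β₁ := by linarith
    obtain ⟨j₀, hj₀m, hiff, hsq, hBf⟩ := hB' β₁ hζ hwin' hβ1
    have hj0 : j₀ = 0 := hiff.mpr hζE
    have hbd := hBf τ' w hw x h hQx hhx hhx'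
    rw [← hm] at hbd
    rw [hj0, pow_zero, Complex.one_re, one_mul] at hbd
    have key := window_transfer hνpos hδν hbd hcomp
    -- Stark: `c₁ Q^{-2} ≤ 1 − β₁ ≤ μ`, so the junk is also relative
    have hβ1ne : ((β₁ : ℝ) : ℂ) ≠ 1 := by
      intro h'; apply hβ1.ne; exact_mod_cast h'
    have hLzero : classGroupLFunction N 1 β₁ = 0 := by
      have := classGroupLFunction_eq_zero_of_famF (K := N) 0 (ρ := (β₁ : ℂ)) (by rw [famF_zero]; exact hζ) hβ1ne
      rwa [toHomUnits_toMulHom_zero] at this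
    have h11 : (1 : ClassGroup (𝓞 N) →* ℂˣ) * 1 = 1 := by ext; simp
    have hδlow : c₁ * ThornerZaman.condQn N ^ (-(2 : ℝ)) ≤ 1 - β₁ := heff N hN 1 h11 β₁ hβ1 hLzero
    have hlogx1 : 1 ≤ Real.log x := by
      rw [Real.le_log_iff_exp_le hx0]; have := Real.exp_one_lt_d9; linarith
    have hμlow : c₁ * ThornerZaman.condQn N ^ (-(2 : ℝ)) ≤ min 1 ((1 - β₁) * Real.log x) := by
      refine le_min hc₁Q1 (hδlow.trans ?_)
      have := mul_le_mul_of_nonneg_left hlogx1 (by linarith : (0:ℝ) ≤ 1 - β₁)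
      linarith
    have hR' : κ / 4 * (c₁ * ThornerZaman.condQn N ^ (-(2 : ℝ))) * h ≤
        κ / 4 * min 1 ((1 - β₁) * Real.log x) * h :=
      mul_le_mul_of_nonneg_right (mul_le_mul_of_nonneg_left hμlow hκ4.le) hh0.le
    have hflat := half_min_mul_le_flat hx1.le hh0.le hβ0 hβ1
    refine key.trans ?_
    have hμ0 : 0 ≤ min 1 ((1 - β₁) * Real.log x) := le_min zero_le_one (by nlinarith)
    have e2 : δC * (κ / 4 * min 1 ((1 - β₁) * Real.log x) * h +
        κ / 4 * (c₁ * ThornerZaman.condQn N ^ (-(2 : ℝ))) * h) ≤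
        δC * (κ * (h / 2 * min 1 ((1 - β₁) * Real.log x))) := by
      refine mul_le_mul_of_nonneg_left ?_ hδCpos.le
      linarith
    refine e2.trans ?_
    have := mul_le_mul_of_nonneg_left hflat (by positivity : 0 ≤ δC * κ)
    nlinarith
  · -- (B), `ζ_E(β₁) ≠ 0`: the sign is `−1`
    have hwin' : 1 - c' / (Real.log d + Real.log 4) < β₁ := by
      have := div_le_div_of_nonneg_right hc₂c' (by linarith : 0 ≤ Real.log d + Real.log 4); linarith
    have hβhalf : 1 / 2 ≤ β₁ := hβhalf_of hc'c hwin'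
    have hβ0 : 0 < β₁ := by linarith
    obtain ⟨j₀, hj₀m, hiff, hsq, hBf⟩ := hB' β₁ hζ hwin' hβ1
    have hj0 : j₀ ≠ 0 := fun h0 => hζE (hiff.mp h0)
    have hneg : ((χ₁ τ' : ℂˣ) : ℂ) ^ j₀ = -1 :=
      character_pow_eq_neg_one χ₁ hχ₁ τ' horder (Nat.pos_of_ne_zero hj0) hj₀m (hsq τ')
    have hre : ((((χ₁ τ' : ℂˣ) : ℂ)⁻¹) ^ j₀).re = -1 := by
      rw [inv_pow, hneg, inv_neg, inv_one, Complex.neg_re, Complex.one_re]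
    have hbd := hBf τ' w hw x h hQx hhx hhx'
    rw [← hm] at hbd
    rw [hre] at hbd
    have e1 : h - (-1) * (((x + h) ^ β₁ - x ^ β₁) / β₁) = h + ((x + h) ^ β₁ - x ^ β₁) / β₁ := by ring
    rw [e1] at hbd
    have hμ1 : κ / 4 * min 1 ((1 - β₁) * Real.log x) * h ≤ κ / 4 * h := by
      have := mul_le_mul_of_nonneg_left (min_le_left 1 ((1 - β₁) * Real.log x)) (by positivity : 0 ≤ κ / 4 * h)
      linarith
    have key := window_transfer hνpos hδν (hbd.trans hμ1) hcomp'
    refine key.trans ?_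
    have hp : 0 ≤ κ * (δC * h) := by positivity
    linarith [hp]

end Summit.QuantumAdvantage.QuantumAdvantage.Theorems.DegreeOnePrimesEscape

end
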